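import Summits.Ventures.PercRepro.Night2FourFatArith

/-!
# PercRepro — the FOUR-hyperplane count of the covering bases: four fat hyperplanes with pairwise DISJOINT missed
sets (night-2, gen 23)

The count of `Night2ThreeFatCount` over three rank-`≤ q` sets is pushed to FOUR sets `H₀, …, H₃ ⊇ K` of `G` missing
`≤ 2` points each with pairwise DISJOINT missed sets (the arithmetic is `Night2FourFatArith`):

* `four_count_assemble` — the linear assembly of the two exact three-set counts, the trace bounds and
  `choose_four_disjoint_le`;
* `card_sdiff_three_powersetCard_add_eq` — the exact three-set inclusion–exclusion for the `ρ`-subsets of a finset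
  `X` that lie inside none of three traces `X ∩ H_i` (pure finset counting);
* `card_inter_four_add_le` — `|S′ ∩ H₀ ∩ H₁ ∩ H₂ ∩ H₃| + Σ_i |S′ ∖ H_i| ≤ |S′|` when the missed sets are pairwise
  disjoint;
* `card_coverBases_le_card_sdiff_three` — the covering bases lie in `N₃(S′) ∖ N₃(S′ ∩ H₃)`, where `N₃(X)` is the
  family of the `ρ`-subsets of `X` inside none of `H₀, H₁, H₂`: `#cb + #N₃(S′ ∩ H₃) ≤ #N₃(S′)`;
* **`card_coverBases_le_cntDisjFour`**: `#coverBases(S) ≤ cntDisjFour ρ |S ∖ K|` for every target `S ⊆ G` (`ρ ≥ 6`).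

With the chord excess of gen 20 the count sum of the cell `(3, 0)` at `n = 11` is `3027/2912 = 1.039 ≥ 1` — the one
`(3, 0)` core cell the three-hyperplane count leaves (`0.932`); see `Night2FourFatCells`.
-/

namespace PercRepro.Shadow

open Finset PerFlat ThmH

/-- The assembly of the four-hyperplane count: from the two exact three-set counts, the trace bounds and
`choose_four_disjoint_le`, `#cb + 4·C(m+6) ≤ C(m+8) + 6·C(m+4)`. -/
theorem four_count_assemble (cb N1 N2 cS cb0 cb1 cb2 cb3 x01 x02 x12 y x30 x31 x32 z y301 y302 y312
    P60 P61 P62 P63 P401 P402 P412 P403 P413 P423 P2012 P2013 P2023 P2123 P0 C8 C6 C4 : ℕ)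
    (h1 : cb + N2 ≤ N1)
    (e1 : N1 + cb0 + cb1 + cb2 + y = cS + x01 + x02 + x12)
    (e2 : N2 + x30 + x31 + x32 + z = cb3 + y301 + y302 + y312)
    (u01 : x01 ≤ P401) (u02 : x02 ≤ P402) (u12 : x12 ≤ P412)
    (u30 : x30 ≤ P403) (u31 : x31 ≤ P413) (u32 : x32 ≤ P423) (uz : z ≤ P0)
    (ly : P2012 ≤ y) (l301 : P2013 ≤ y301) (l302 : P2023 ≤ y302) (l312 : P2123 ≤ y312)
    (c0 : cb0 = P60) (c1 : cb1 = P61) (c2 : cb2 = P62) (c3 : cb3 = P63) (cs : cS = C8)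
    (h3 : 4 * C6 + P401 + P402 + P412 + P403 + P413 + P423 + P0 ≤
      P60 + P61 + P62 + P63 + P2012 + P2013 + P2023 + P2123 + 6 * C4) :
    cb + 4 * C6 ≤ C8 + 6 * C4 := by
  omega

variable {α : Type*} [DecidableEq α]

/-- **The exact three-set inclusion–exclusion for the `ρ`-subsets of `X` inside none of three traces**:
`#N₃(X) + Σ_i C(|X ∩ H_i|) + C(|X ∩ H₀ ∩ H₁ ∩ H₂|) = C(|X|) + Σ_{i<j} C(|X ∩ H_i ∩ H_j|)`. -/
theorem card_sdiff_three_powersetCard_add_eq (ρ : ℕ) (X H₀ H₁ H₂ : Finset α) :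
    (X.powersetCard ρ \ ((X ∩ H₀).powersetCard ρ ∪ (X ∩ H₁).powersetCard ρ ∪
        (X ∩ H₂).powersetCard ρ)).card + (X ∩ H₀).card.choose ρ + (X ∩ H₁).card.choose ρ +
        (X ∩ H₂).card.choose ρ + (X ∩ H₀ ∩ H₁ ∩ H₂).card.choose ρ =
      X.card.choose ρ + (X ∩ H₀ ∩ H₁).card.choose ρ + (X ∩ H₀ ∩ H₂).card.choose ρ +
        (X ∩ H₁ ∩ H₂).card.choose ρ := by
  set P₀ := (X ∩ H₀).powersetCard ρ with hP₀
  set P₁ := (X ∩ H₁).powersetCard ρ with hP₁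
  set P₂ := (X ∩ H₂).powersetCard ρ with hP₂
  have hUsub : P₀ ∪ P₁ ∪ P₂ ⊆ X.powersetCard ρ := by
    apply Finset.union_subset
    · apply Finset.union_subset
      · exact Finset.powersetCard_mono Finset.inter_subset_left
      · exact Finset.powersetCard_mono Finset.inter_subset_left
    · exact Finset.powersetCard_mono Finset.inter_subset_left
  have h1 := Finset.card_sdiff_of_subset hUsub
  have hUle := Finset.card_le_card hUsub
  have h2 := Finset.card_union_add_card_inter (P₀ ∪ P₁) P₂
  have h3 := Finset.card_union_add_card_inter P₀ P₁
  have hdist : (P₀ ∪ P₁) ∩ P₂ = (P₀ ∩ P₂) ∪ (P₁ ∩ P₂) := Finset.union_inter_distrib_right P₀ P₁ P₂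
  have h4 := Finset.card_union_add_card_inter (P₀ ∩ P₂) (P₁ ∩ P₂)
  have h01 : P₀ ∩ P₁ = (X ∩ H₀ ∩ H₁).powersetCard ρ := by
    rw [hP₀, hP₁, powersetCard_inter_eq]
    congr 1
    ext x
    simp only [Finset.mem_inter]
    tauto
  have h02 : P₀ ∩ P₂ = (X ∩ H₀ ∩ H₂).powersetCard ρ := by
    rw [hP₀, hP₂, powersetCard_inter_eq]
    congr 1
    ext x
    simp only [Finset.mem_inter]
    tauto
  have h12 : P₁ ∩ P₂ = (X ∩ H₁ ∩ H₂).powersetCard ρ := by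
    rw [hP₁, hP₂, powersetCard_inter_eq]
    congr 1
    ext x
    simp only [Finset.mem_inter]
    tauto
  have h012 : (P₀ ∩ P₂) ∩ (P₁ ∩ P₂) = (X ∩ H₀ ∩ H₁ ∩ H₂).powersetCard ρ := by
    rw [h02, h12, powersetCard_inter_eq]
    congr 1
    ext x
    simp only [Finset.mem_inter]
    tauto
  rw [hdist, h02, h12] at h2
  rw [h012, h02, h12] at h4
  rw [h01] at h3
  rw [Finset.card_powersetCard, Finset.card_powersetCard, Finset.card_powersetCard] at h4
  rw [Finset.card_powersetCard, Finset.card_powersetCard, Finset.card_powersetCard] at h3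
  rw [Finset.card_powersetCard] at h2 h1 hUle
  omega

/-- The quadruple trace is small when the missed parts are pairwise disjoint:
`|S′ ∩ H₀ ∩ H₁ ∩ H₂ ∩ H₃| + Σ_i |S′ ∖ H_i| ≤ |S′|` for `S′ ⊆ G` and pairwise disjoint `G ∖ H_i`. -/
theorem card_inter_four_add_le {G H₀ H₁ H₂ H₃ S' : Finset α} (hS : S' ⊆ G)
    (hd₀₁ : (G \ H₀) ∩ (G \ H₁) = ∅) (hd₀₂ : (G \ H₀) ∩ (G \ H₂) = ∅) (hd₀₃ : (G \ H₀) ∩ (G \ H₃) = ∅)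
    (hd₁₂ : (G \ H₁) ∩ (G \ H₂) = ∅) (hd₁₃ : (G \ H₁) ∩ (G \ H₃) = ∅) (hd₂₃ : (G \ H₂) ∩ (G \ H₃) = ∅) :
    (S' ∩ H₀ ∩ H₁ ∩ H₂ ∩ H₃).card + (S' \ H₀).card + (S' \ H₁).card + (S' \ H₂).card + (S' \ H₃).card ≤
      S'.card := by
  -- pairwise disjointness of the missed parts of the target
  have hdis : ∀ {A B : Finset α}, (G \ A) ∩ (G \ B) = ∅ → Disjoint (S' \ A) (S' \ B) := by
    intro A B hAB
    rw [Finset.disjoint_left]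
    intro x hx hx'
    have : x ∈ (G \ A) ∩ (G \ B) := by
      simp only [Finset.mem_inter, Finset.mem_sdiff] at hx hx' ⊢
      exact ⟨⟨hS hx.1, hx.2⟩, ⟨hS hx'.1, hx'.2⟩⟩
    rw [hAB] at this
    exact Finset.notMem_empty x this
  have hsub : (S' ∩ H₀ ∩ H₁ ∩ H₂ ∩ H₃) ∪ (S' \ H₀) ∪ (S' \ H₁) ∪ (S' \ H₂) ∪ (S' \ H₃) ⊆ S' := by
    intro x hx
    simp only [Finset.mem_union, Finset.mem_inter, Finset.mem_sdiff] at hx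
    tauto
  have h1 := Finset.card_le_card hsub
  have hd1 : Disjoint (S' ∩ H₀ ∩ H₁ ∩ H₂ ∩ H₃) (S' \ H₀) := by
    rw [Finset.disjoint_left]
    intro x hx hx'
    simp only [Finset.mem_inter, Finset.mem_sdiff] at hx hx'
    exact hx'.2 hx.1.1.1.2
  have hd2 : Disjoint ((S' ∩ H₀ ∩ H₁ ∩ H₂ ∩ H₃) ∪ (S' \ H₀)) (S' \ H₁) := by
    rw [Finset.disjoint_union_left]
    refine ⟨?_, hdis hd₀₁⟩
    rw [Finset.disjoint_left]
    intro x hx hx'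
    simp only [Finset.mem_inter, Finset.mem_sdiff] at hx hx'
    exact hx'.2 hx.1.1.2
  have hd3 : Disjoint ((S' ∩ H₀ ∩ H₁ ∩ H₂ ∩ H₃) ∪ (S' \ H₀) ∪ (S' \ H₁)) (S' \ H₂) := by
    rw [Finset.disjoint_union_left, Finset.disjoint_union_left]
    refine ⟨⟨?_, hdis hd₀₂⟩, hdis hd₁₂⟩
    rw [Finset.disjoint_left]
    intro x hx hx'
    simp only [Finset.mem_inter, Finset.mem_sdiff] at hx hx'
    exact hx'.2 hx.1.2
  have hd4 : Disjoint ((S' ∩ H₀ ∩ H₁ ∩ H₂ ∩ H₃) ∪ (S' \ H₀) ∪ (S' \ H₁) ∪ (S' \ H₂)) (S' \ H₃) := by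
    rw [Finset.disjoint_union_left, Finset.disjoint_union_left, Finset.disjoint_union_left]
    refine ⟨⟨⟨?_, hdis hd₀₃⟩, hdis hd₁₃⟩, hdis hd₂₃⟩
    rw [Finset.disjoint_left]
    intro x hx hx'
    simp only [Finset.mem_inter, Finset.mem_sdiff] at hx hx'
    exact hx'.2 hx.2
  rw [Finset.card_union_of_disjoint hd4, Finset.card_union_of_disjoint hd3, Finset.card_union_of_disjoint hd2,
    Finset.card_union_of_disjoint hd1] at h1
  exact h1

variable {M : Matroid α} [M.Finite]

open scoped Classical in
/-- The covering bases lie in `N₃(S′) ∖ N₃(S′ ∩ H₃)`: `#coverBases(S) ≤ #N₃(S′) − #N₃(S′ ∩ H₃)`, where `N₃(X)` is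
the family of the `ρ`-subsets of `X` inside none of the rank-`≤ q` sets `H₀, H₁, H₂ ⊇ K` (and `H₃ ⊇ K` is a fourth). -/
theorem card_coverBases_le_card_sdiff_three {q ρ : ℕ} {G : Finset α} (hk : kColoops M G + ρ = q + 1)
    {H₀ H₁ H₂ H₃ : Finset α} (hK₀ : coloops M G ⊆ H₀) (hH₀ : M.eRk (H₀ : Set α) ≤ (q : ℕ∞))
    (hK₁ : coloops M G ⊆ H₁) (hH₁ : M.eRk (H₁ : Set α) ≤ (q : ℕ∞))
    (hK₂ : coloops M G ⊆ H₂) (hH₂ : M.eRk (H₂ : Set α) ≤ (q : ℕ∞))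
    (hK₃ : coloops M G ⊆ H₃) (hH₃ : M.eRk (H₃ : Set α) ≤ (q : ℕ∞)) (S : Finset α) :
    (coverBases M G S ρ).card +
      (((S \ coloops M G) ∩ H₃).powersetCard ρ \ ((((S \ coloops M G) ∩ H₃) ∩ H₀).powersetCard ρ ∪
        (((S \ coloops M G) ∩ H₃) ∩ H₁).powersetCard ρ ∪ (((S \ coloops M G) ∩ H₃) ∩ H₂).powersetCard ρ)).card ≤
      ((S \ coloops M G).powersetCard ρ \ (((S \ coloops M G) ∩ H₀).powersetCard ρ ∪
        ((S \ coloops M G) ∩ H₁).powersetCard ρ ∪ ((S \ coloops M G) ∩ H₂).powersetCard ρ)).card := by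
  set S' := S \ coloops M G with hS'
  -- no covering basis inside a rank-`≤ q` trace
  have hnot : ∀ {H : Finset α}, coloops M G ⊆ H → M.eRk (H : Set α) ≤ (q : ℕ∞) →
      ∀ T ∈ coverBases M G S ρ, ¬ T ⊆ H := by
    intro H hKH hH T hT hTH
    unfold coverBases at hT
    rw [Finset.mem_filter] at hT
    obtain ⟨hTp, hind⟩ := hT
    rw [Finset.mem_powersetCard] at hTp
    have hTK : Disjoint (coloops M G) T := by
      rw [Finset.disjoint_left]
      intro x hx hxT
      exact (Finset.mem_sdiff.1 (hTp.1 hxT)).2 hx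
    have hcard : (coloops M G ∪ T).card = q + 1 := by
      rw [Finset.card_union_of_disjoint hTK, ← kColoops_eq_card_coloops, hTp.2, hk]
    have hKT : ((coloops M G ∪ T : Finset α) : Set α) ⊆ (H : Set α) := by
      rw [Finset.coe_subset]
      exact Finset.union_subset hKH hTH
    have h1 := hind.encard_le_eRk_of_subset hKT
    rw [Set.encard_coe_eq_coe_finsetCard, hcard] at h1
    have h2 : ((q + 1 : ℕ) : ℕ∞) ≤ (q : ℕ∞) := h1.trans hH
    have h3 : q + 1 ≤ q := by exact_mod_cast h2
    omega
  -- the families `N₃(X)` for `X = S′` and `X = S′ ∩ H₃`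
  have hNsub : (S' ∩ H₃).powersetCard ρ \ (((S' ∩ H₃) ∩ H₀).powersetCard ρ ∪
      ((S' ∩ H₃) ∩ H₁).powersetCard ρ ∪ ((S' ∩ H₃) ∩ H₂).powersetCard ρ) ⊆
      S'.powersetCard ρ \ ((S' ∩ H₀).powersetCard ρ ∪ (S' ∩ H₁).powersetCard ρ ∪
      (S' ∩ H₂).powersetCard ρ) := by
    intro T hT
    rw [Finset.mem_sdiff] at hT ⊢
    obtain ⟨hT1, hT2⟩ := hT
    rw [Finset.mem_powersetCard] at hT1
    refine ⟨?_, ?_⟩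
    · rw [Finset.mem_powersetCard]
      exact ⟨hT1.1.trans Finset.inter_subset_left, hT1.2⟩
    · intro hmem
      apply hT2
      rw [Finset.mem_union, Finset.mem_union] at hmem ⊢
      rcases hmem with (h | h) | h
      · left; left
        rw [Finset.mem_powersetCard] at h ⊢
        exact ⟨Finset.subset_inter hT1.1 (h.1.trans Finset.inter_subset_right), h.2⟩
      · left; right
        rw [Finset.mem_powersetCard] at h ⊢
        exact ⟨Finset.subset_inter hT1.1 (h.1.trans Finset.inter_subset_right), h.2⟩
      · right
        rw [Finset.mem_powersetCard] at h ⊢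
        exact ⟨Finset.subset_inter hT1.1 (h.1.trans Finset.inter_subset_right), h.2⟩
  have hcb : coverBases M G S ρ ⊆ (S'.powersetCard ρ \ ((S' ∩ H₀).powersetCard ρ ∪
      (S' ∩ H₁).powersetCard ρ ∪ (S' ∩ H₂).powersetCard ρ)) \
      ((S' ∩ H₃).powersetCard ρ \ (((S' ∩ H₃) ∩ H₀).powersetCard ρ ∪
      ((S' ∩ H₃) ∩ H₁).powersetCard ρ ∪ ((S' ∩ H₃) ∩ H₂).powersetCard ρ)) := by
    intro T hT
    have hTp : T ∈ S'.powersetCard ρ := by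
      unfold coverBases at hT
      exact (Finset.mem_filter.1 hT).1
    rw [Finset.mem_sdiff, Finset.mem_sdiff]
    refine ⟨⟨hTp, ?_⟩, ?_⟩
    · intro hmem
      rw [Finset.mem_union, Finset.mem_union] at hmem
      rcases hmem with (h | h) | h
      · exact hnot hK₀ hH₀ T hT ((Finset.mem_powersetCard.1 h).1.trans Finset.inter_subset_right)
      · exact hnot hK₁ hH₁ T hT ((Finset.mem_powersetCard.1 h).1.trans Finset.inter_subset_right)
      · exact hnot hK₂ hH₂ T hT ((Finset.mem_powersetCard.1 h).1.trans Finset.inter_subset_right)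
    · intro hmem
      rw [Finset.mem_sdiff] at hmem
      exact hnot hK₃ hH₃ T hT ((Finset.mem_powersetCard.1 hmem.1).1.trans Finset.inter_subset_right)
  have h1 := Finset.card_le_card hcb
  rw [Finset.card_sdiff_of_subset hNsub] at h1
  have h2 := Finset.card_le_card hNsub
  omega

open scoped Classical in
/-- **The four-disjoint-hyperplane count**: four rank-`≤ q` sets `H₀, …, H₃ ⊇ K` missing `≤ 2` points of `G` each,
with pairwise DISJOINT missed sets, bound the covering bases of every target `S ⊆ G` by `cntDisjFour ρ |S ∖ K|`
(`ρ ≥ 6`). -/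
theorem card_coverBases_le_cntDisjFour {q ρ : ℕ} {G : Finset α} (hk : kColoops M G + ρ = q + 1) (hρ : 6 ≤ ρ)
    {H₀ H₁ H₂ H₃ : Finset α} (hK₀ : coloops M G ⊆ H₀) (hH₀ : M.eRk (H₀ : Set α) ≤ (q : ℕ∞))
    (hK₁ : coloops M G ⊆ H₁) (hH₁ : M.eRk (H₁ : Set α) ≤ (q : ℕ∞))
    (hK₂ : coloops M G ⊆ H₂) (hH₂ : M.eRk (H₂ : Set α) ≤ (q : ℕ∞))
    (hK₃ : coloops M G ⊆ H₃) (hH₃ : M.eRk (H₃ : Set α) ≤ (q : ℕ∞))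
    (hm₀ : (G \ H₀).card ≤ 2) (hm₁ : (G \ H₁).card ≤ 2) (hm₂ : (G \ H₂).card ≤ 2) (hm₃ : (G \ H₃).card ≤ 2)
    (hd₀₁ : (G \ H₀) ∩ (G \ H₁) = ∅) (hd₀₂ : (G \ H₀) ∩ (G \ H₂) = ∅) (hd₀₃ : (G \ H₀) ∩ (G \ H₃) = ∅)
    (hd₁₂ : (G \ H₁) ∩ (G \ H₂) = ∅) (hd₁₃ : (G \ H₁) ∩ (G \ H₃) = ∅) (hd₂₃ : (G \ H₂) ∩ (G \ H₃) = ∅)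
    {S : Finset α} (hSG : S ⊆ G) :
    ((coverBases M G S ρ).card : ℚ) ≤ cntDisjFour ρ (S \ coloops M G).card := by
  set S' := S \ coloops M G with hS'
  have hS'G : S' ⊆ G := Finset.sdiff_subset.trans hSG
  have h0 : (coverBases M G S ρ).card ≤ S'.card.choose ρ := card_coverBases_le G S ρ
  by_cases hsmall : S'.card ≤ ρ + 1
  · unfold cntDisjFour
    rw [Nat.choose_eq_zero_of_lt (by omega : S'.card - 2 < ρ), Nat.choose_eq_zero_of_lt (by omega : S'.card - 4 < ρ)]
    have h5 := (Nat.cast_le (α := ℚ)).2 h0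
    push_cast at h5 ⊢
    linarith
  push Not at hsmall
  obtain ⟨t, rfl⟩ : ∃ t, ρ = t + 4 := ⟨ρ - 4, by omega⟩
  obtain ⟨m, hm⟩ : ∃ m, S'.card = m + 8 := ⟨S'.card - 8, by omega⟩
  -- the missed parts of the target and the traces
  have ha₀ : (S' \ H₀).card ≤ 2 := (Finset.card_le_card (Finset.sdiff_subset_sdiff hS'G le_rfl)).trans hm₀
  have ha₁ : (S' \ H₁).card ≤ 2 := (Finset.card_le_card (Finset.sdiff_subset_sdiff hS'G le_rfl)).trans hm₁
  have ha₂ : (S' \ H₂).card ≤ 2 := (Finset.card_le_card (Finset.sdiff_subset_sdiff hS'G le_rfl)).trans hm₂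
  have ha₃ : (S' \ H₃).card ≤ 2 := (Finset.card_le_card (Finset.sdiff_subset_sdiff hS'G le_rfl)).trans hm₃
  have hb₀ := Finset.card_sdiff_add_card_inter S' H₀
  have hb₁ := Finset.card_sdiff_add_card_inter S' H₁
  have hb₂ := Finset.card_sdiff_add_card_inter S' H₂
  have hb₃ := Finset.card_sdiff_add_card_inter S' H₃
  have hx₀₁ := card_inter_inter_le (H₀ := H₀) (H₁ := H₁) hS'G
  have hx₀₂ := card_inter_inter_le (H₀ := H₀) (H₁ := H₂) hS'G
  have hx₁₂ := card_inter_inter_le (H₀ := H₁) (H₁ := H₂) hS'G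
  have hx₃₀ := card_inter_inter_le (H₀ := H₃) (H₁ := H₀) hS'G
  have hx₃₁ := card_inter_inter_le (H₀ := H₃) (H₁ := H₁) hS'G
  have hx₃₂ := card_inter_inter_le (H₀ := H₃) (H₁ := H₂) hS'G
  rw [hd₀₁, Finset.card_empty] at hx₀₁
  rw [hd₀₂, Finset.card_empty] at hx₀₂
  rw [hd₁₂, Finset.card_empty] at hx₁₂
  rw [Finset.inter_comm (G \ H₃) (G \ H₀), hd₀₃, Finset.card_empty] at hx₃₀
  rw [Finset.inter_comm (G \ H₃) (G \ H₁), hd₁₃, Finset.card_empty] at hx₃₁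
  rw [Finset.inter_comm (G \ H₃) (G \ H₂), hd₂₃, Finset.card_empty] at hx₃₂
  have hy := card_inter_three_add_ge H₀ H₁ H₂ S'
  have hy₃₀₁ := card_inter_three_add_ge H₃ H₀ H₁ S'
  have hy₃₀₂ := card_inter_three_add_ge H₃ H₀ H₂ S'
  have hy₃₁₂ := card_inter_three_add_ge H₃ H₁ H₂ S'
  have hz := card_inter_four_add_le hS'G hd₀₁ hd₀₂ hd₀₃ hd₁₂ hd₁₃ hd₂₃
  have hz' : (S' ∩ H₃ ∩ H₀ ∩ H₁ ∩ H₂).card = (S' ∩ H₀ ∩ H₁ ∩ H₂ ∩ H₃).card := by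
    rw [Finset.inter_right_comm S' H₃ H₀, Finset.inter_right_comm (S' ∩ H₀) H₃ H₁,
      Finset.inter_right_comm (S' ∩ H₀ ∩ H₁) H₃ H₂]
  -- name the complements `p_i = 2 − a_i`
  obtain ⟨p₀, hp₀⟩ : ∃ p₀, (S' \ H₀).card + p₀ = 2 := ⟨2 - (S' \ H₀).card, Nat.add_sub_cancel' ha₀⟩
  obtain ⟨p₁, hp₁⟩ : ∃ p₁, (S' \ H₁).card + p₁ = 2 := ⟨2 - (S' \ H₁).card, Nat.add_sub_cancel' ha₁⟩
  obtain ⟨p₂, hp₂⟩ : ∃ p₂, (S' \ H₂).card + p₂ = 2 := ⟨2 - (S' \ H₂).card, Nat.add_sub_cancel' ha₂⟩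
  obtain ⟨p₃, hp₃⟩ : ∃ p₃, (S' \ H₃).card + p₃ = 2 := ⟨2 - (S' \ H₃).card, Nat.add_sub_cancel' ha₃⟩
  -- the trace sizes (the irrelevant arithmetic facts are cleared first: omega sees only the card facts)
  clear h0 hsmall hρ hm₀ hm₁ hm₂ hm₃ ha₀ ha₁ ha₂ ha₃
  have q₀ : p₀ ≤ 2 := (Nat.le_add_left p₀ _).trans hp₀.le
  have q₁ : p₁ ≤ 2 := (Nat.le_add_left p₁ _).trans hp₁.le
  have q₂ : p₂ ≤ 2 := (Nat.le_add_left p₂ _).trans hp₂.le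
  have q₃ : p₃ ≤ 2 := (Nat.le_add_left p₃ _).trans hp₃.le
  have hcb : (S' ∩ H₀).card = m + 6 + p₀ ∧ (S' ∩ H₁).card = m + 6 + p₁ ∧ (S' ∩ H₂).card = m + 6 + p₂ ∧
      (S' ∩ H₃).card = m + 6 + p₃ := by
    clear hx₀₁ hx₀₂ hx₁₂ hx₃₀ hx₃₁ hx₃₂ hy hy₃₀₁ hy₃₀₂ hy₃₁₂ hz hz'
    omega
  obtain ⟨hcb₀, hcb₁, hcb₂, hcb₃⟩ := hcb
  have hsx : (S' ∩ H₀ ∩ H₁).card ≤ m + 4 + p₀ + p₁ ∧ (S' ∩ H₀ ∩ H₂).card ≤ m + 4 + p₀ + p₂ ∧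
      (S' ∩ H₁ ∩ H₂).card ≤ m + 4 + p₁ + p₂ ∧ (S' ∩ H₃ ∩ H₀).card ≤ m + 4 + p₀ + p₃ ∧
      (S' ∩ H₃ ∩ H₁).card ≤ m + 4 + p₁ + p₃ ∧ (S' ∩ H₃ ∩ H₂).card ≤ m + 4 + p₂ + p₃ := by
    clear hb₀ hb₁ hb₂ hb₃ hcb₀ hcb₁ hcb₂ hcb₃ hy hy₃₀₁ hy₃₀₂ hy₃₁₂ hz hz'
    omega
  obtain ⟨s₀₁, s₀₂, s₁₂, s₃₀, s₃₁, s₃₂⟩ := hsx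
  have hsy : m + 2 + p₀ + p₁ + p₂ ≤ (S' ∩ H₀ ∩ H₁ ∩ H₂).card ∧
      m + 2 + p₀ + p₁ + p₃ ≤ (S' ∩ H₃ ∩ H₀ ∩ H₁).card ∧ m + 2 + p₀ + p₂ + p₃ ≤ (S' ∩ H₃ ∩ H₀ ∩ H₂).card ∧
      m + 2 + p₁ + p₂ + p₃ ≤ (S' ∩ H₃ ∩ H₁ ∩ H₂).card := by
    clear hb₀ hb₁ hb₂ hb₃ hcb₀ hcb₁ hcb₂ hcb₃ hx₀₁ hx₀₂ hx₁₂ hx₃₀ hx₃₁ hx₃₂ s₀₁ s₀₂ s₁₂ s₃₀ s₃₁ s₃₂ hz hz'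
    omega
  obtain ⟨sy, s₃₀₁, s₃₀₂, s₃₁₂⟩ := hsy
  have sz : (S' ∩ H₃ ∩ H₀ ∩ H₁ ∩ H₂).card ≤ m + p₀ + p₁ + p₂ + p₃ := by
    clear hb₀ hb₁ hb₂ hb₃ hcb₀ hcb₁ hcb₂ hcb₃ hx₀₁ hx₀₂ hx₁₂ hx₃₀ hx₃₁ hx₃₂ s₀₁ s₀₂ s₁₂ s₃₀ s₃₁ s₃₂
      hy hy₃₀₁ hy₃₀₂ hy₃₁₂ sy s₃₀₁ s₃₀₂ s₃₁₂
    omega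
  -- upper bounds on the positive terms, lower bounds on the negative ones
  have u₀₁ := Nat.choose_le_choose (t + 4) s₀₁
  have u₀₂ := Nat.choose_le_choose (t + 4) s₀₂
  have u₁₂ := Nat.choose_le_choose (t + 4) s₁₂
  have u₃₀ := Nat.choose_le_choose (t + 4) s₃₀
  have u₃₁ := Nat.choose_le_choose (t + 4) s₃₁
  have u₃₂ := Nat.choose_le_choose (t + 4) s₃₂
  have uz := Nat.choose_le_choose (t + 4) sz
  have ly := Nat.choose_le_choose (t + 4) sy
  have l₃₀₁ := Nat.choose_le_choose (t + 4) s₃₀₁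
  have l₃₀₂ := Nat.choose_le_choose (t + 4) s₃₀₂
  have l₃₁₂ := Nat.choose_le_choose (t + 4) s₃₁₂
  have h3 := choose_four_disjoint_le t m p₀ p₁ p₂ p₃ q₀ q₁ q₂ q₃
  have h1 := card_coverBases_le_card_sdiff_three hk hK₀ hH₀ hK₁ hH₁ hK₂ hH₂ hK₃ hH₃ S
  rw [← hS'] at h1
  have e1 := card_sdiff_three_powersetCard_add_eq (t + 4) S' H₀ H₁ H₂
  have e2 := card_sdiff_three_powersetCard_add_eq (t + 4) (S' ∩ H₃) H₀ H₁ H₂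
  have c₀ : (S' ∩ H₀).card.choose (t + 4) = (m + 6 + p₀).choose (t + 4) := by rw [hcb₀]
  have c₁ : (S' ∩ H₁).card.choose (t + 4) = (m + 6 + p₁).choose (t + 4) := by rw [hcb₁]
  have c₂ : (S' ∩ H₂).card.choose (t + 4) = (m + 6 + p₂).choose (t + 4) := by rw [hcb₂]
  have c₃ : (S' ∩ H₃).card.choose (t + 4) = (m + 6 + p₃).choose (t + 4) := by rw [hcb₃]
  have cs : S'.card.choose (t + 4) = (m + 8).choose (t + 4) := by rw [hm]
  generalize hN1 : (S'.powersetCard (t + 4) \ ((S' ∩ H₀).powersetCard (t + 4) ∪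
    (S' ∩ H₁).powersetCard (t + 4) ∪ (S' ∩ H₂).powersetCard (t + 4))).card = N1 at h1 e1
  generalize hN2 : ((S' ∩ H₃).powersetCard (t + 4) \ (((S' ∩ H₃) ∩ H₀).powersetCard (t + 4) ∪
    ((S' ∩ H₃) ∩ H₁).powersetCard (t + 4) ∪ ((S' ∩ H₃) ∩ H₂).powersetCard (t + 4))).card = N2 at h1 e2
  generalize hcbg : (coverBases M G S (t + 4)).card = cb at h1 ⊢
  have h4 : cb + 4 * (m + 6).choose (t + 4) ≤ (m + 8).choose (t + 4) + 6 * (m + 4).choose (t + 4) :=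
    four_count_assemble _ _ _ _ _ _ _ _ _ _ _ _ _ _ _ _ _ _ _ _ _ _ _ _ _ _ _ _ _ _ _ _ _ _ _ _ _
      h1 e1 e2 u₀₁ u₀₂ u₁₂ u₃₀ u₃₁ u₃₂ uz ly l₃₀₁ l₃₀₂ l₃₁₂ c₀ c₁ c₂ c₃ cs h3
  unfold cntDisjFour
  rw [hm, show m + 8 - 2 = m + 6 from rfl, show m + 8 - 4 = m + 4 from rfl]
  have h5 := (Nat.cast_le (α := ℚ)).2 h4
  push_cast at h5
  linarith only [h5]

end PercRepro.Shadow
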